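import Mathlib.RingTheory.PowerSeries.Inverse
import Mathlib.Tactic.LinearCombination
import HarnessLib

/-!
# Class X9, KOLY-MEMO v1.6 §5.7: the involution `ι` of the cyclotomic deformation breaks the
# alternation — the ring identities behind Lemma 5.7.B, kernel-checked (cell `bsd-smallim`, seat `koly`, gen 3)

HONEST FRAMING (cell `bsd-smallim`): the memo HOME/koly/KOLY-MEMO.md v1.6 §5.7 removes the
non-degeneracy hypothesis (ND) of its Theorem 5.6.3 by one observation: the Tate dual of the mod-`p`
cyclotomic deformation `E[p] ⊗ 𝔽_p⟦T⟧(χ_Λ)` carries `χ_Λ^{-1}`, so a Galois-equivariant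
identification of `𝒯_e = E[p] ⊗ A_e(χ)` (`A_e = 𝔽_p[T]/(T^e)`) with its dual is `ι`-SEMILINEAR for
the involution `ι(γ) = γ^{-1}` of `Λ`, i.e. `ι(1+T) = (1+T)^{-1}`; along the graph of such a map the
`A_e`-valued local pairing is `u·e_p(v₂,v₁)·(a₁ι(a₂) − a₂ι(a₁))` (memo (5.7.B.1)), which at
`x = v₁⊗1 + v₂⊗T` equals `u·ε·(ι(T) − T)`, and

  `ι(T) − T = (1+T)^{-1} − (1+T) = −T·(T + 2)·(1+T)^{-1}`  has `T`-valuation exactly `1` (`p ≠ 2`).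

This file proves the RING-THEORETIC content of that sentence — nothing Galois-theoretic, nothing
about any curve: (1) the unit identity `g⁻¹ − g = −g⁻¹(g − 1)(g + 1)`; (2) in `R⟦X⟧`, for any `s`
with `(1 + X)·s = 1`: `(s − 1) − X = −X(X + 2)s`, `coeff₀ = 0`, `coeff₁ = −2`; (3) over a field `k`
with `2 ≠ 0`: `X² ∤ ((1+X)⁻¹ − 1 − X)` in `k⟦X⟧` (so a fortiori `≠ 0 mod T²` in every truncation
`k[T]/(T^e)`, `e ≥ 2`); (4) the `2 × 2` expansion (5.7.B.1) of the pairing along an `ι`-semilinear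
graph against an alternating form. Theorems only (no definition, no named fact); Mathlib algebra.
-/

-- the summit and its single problem are both named `BirchSwinnertonDyer` (registry layout D-0017)
set_option linter.dupNamespace false

set_option autoImplicit false

namespace Summit.BirchSwinnertonDyer.BirchSwinnertonDyer.Rank1Residual.IotaPairing

open PowerSeries

/-- **`ι(g) − g` for `ι(g) = g⁻¹`.** In any commutative ring, for a unit `g`:
`g⁻¹ − g = −g⁻¹·(g − 1)·(g + 1)`. With `g = 1 + T` (the image of the topological generator `γ` in
`Λ/p = 𝔽_p⟦T⟧` or in `A_e = 𝔽_p[T]/(T^e)`), this is `ι(T) − T = −(1+T)⁻¹·T·(T + 2)`: a unit times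
`T` as soon as `2` and `T + 2` are units (memo KOLY-MEMO v1.6 (N4)). [folklore] -/
theorem units_inv_sub_self {A : Type*} [CommRing A] (g : Aˣ) :
    (↑g⁻¹ : A) - (g : A) = -((↑g⁻¹ : A) * ((g : A) - 1) * ((g : A) + 1)) := by
  have h : (↑g⁻¹ : A) * (g : A) = 1 := Units.inv_mul g
  linear_combination (g : A) * h

/-- **`ι(T) − T` in closed form.** In `R⟦X⟧` (any commutative ring `R`), if `s` is an inverse of
`1 + X` then `(s − 1) − X = −X·(X + 2)·s`; here `s − 1 = ι(X)` for the continuous involution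
`ι(1 + X) = (1 + X)⁻¹`. [folklore] -/
theorem inv_sub_one_sub_X_eq {R : Type*} [CommRing R] (s : R⟦X⟧) (hs : (1 + X) * s = 1) :
    (s - 1) - X = -(X * (X + 2) * s) := by
  linear_combination (1 + X) * hs

/-- The constant and the linear coefficient of an inverse `s` of `1 + X` in `R⟦X⟧`: `s₀ = 1`,
`s₁ = −1`. [folklore] -/
theorem coeff_zero_one_of_one_add_X_mul {R : Type*} [CommRing R] (s : R⟦X⟧)
    (hs : (1 + X) * s = 1) : coeff 0 s = 1 ∧ coeff 1 s = -1 := by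
  have hs' : s + X * s = 1 := by rw [← hs]; ring
  have h0 := congrArg (coeff 0) hs'
  have h1 := congrArg (coeff 1) hs'
  simp only [map_add, coeff_zero_X_mul, add_zero, coeff_one, if_true] at h0
  simp only [map_add, coeff_succ_X_mul, coeff_one, one_ne_zero, if_false] at h1
  rw [h0] at h1
  exact ⟨h0, by linear_combination h1⟩

/-- **`ι(X) − X ≡ −2X (mod X²)`.** For an inverse `s` of `1 + X` in `R⟦X⟧`, the power series
`ι(X) − X = (s − 1) − X` has constant coefficient `0` and linear coefficient `−2` (memo (N4):
`ι(T) − T = −2T + O(T²)`). [folklore] -/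
theorem coeff_inv_sub_one_sub_X {R : Type*} [CommRing R] (s : R⟦X⟧) (hs : (1 + X) * s = 1) :
    coeff 0 ((s - 1) - X) = 0 ∧ coeff 1 ((s - 1) - X) = -2 := by
  obtain ⟨h0, h1⟩ := coeff_zero_one_of_one_add_X_mul s hs
  constructor
  · simp only [map_sub, h0, coeff_one, if_true, coeff_zero_eq_constantCoeff_apply, constantCoeff_X,
      sub_self]
  · simp only [map_sub, h1, coeff_one, one_ne_zero, if_false, coeff_one_X]
    ring

/-- Over a field the inverse `(1 + X)⁻¹ ∈ k⟦X⟧` exists and is an inverse: `(1 + X)·(1 + X)⁻¹ = 1`.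
[folklore] -/
theorem one_add_X_mul_inv {k : Type*} [Field k] : (1 + X : k⟦X⟧) * (1 + X)⁻¹ = 1 :=
  PowerSeries.mul_inv_cancel _ (by
    rw [map_add, map_one, constantCoeff_X, add_zero]; exact one_ne_zero)

/-- **`X² ∤ ι(X) − X` when `2 ≠ 0`** (memo (N4), the constant `−2`): over a field `k` of
characteristic `≠ 2`, the power series `(1 + X)⁻¹ − 1 − X ∈ k⟦X⟧` is NOT divisible by `X²`; hence
its image in every truncation `k[X]/(X^e)`, `e ≥ 2` — the rings `A_e = 𝔽_p[T]/(T^e)` of the memo —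
is `X·(unit)`, of `X`-valuation exactly `1`. This is the point where `p ≠ 2` enters Theorem 5.7.1.
[folklore] -/
theorem not_X_sq_dvd_inv_sub_one_sub_X {k : Type*} [Field k] (h2 : (2 : k) ≠ 0) :
    ¬ (X : k⟦X⟧) ^ 2 ∣ ((1 + X : k⟦X⟧)⁻¹ - 1) - X := by
  intro hdvd
  have h1 := (coeff_inv_sub_one_sub_X ((1 + X : k⟦X⟧)⁻¹) one_add_X_mul_inv).2
  rw [X_pow_dvd_iff] at hdvd
  have h0 : coeff 1 (((1 + X : k⟦X⟧)⁻¹ - 1) - X) = 0 := hdvd 1 (by norm_num)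
  rw [h0] at h1
  exact h2 (by linear_combination h1)

/-- And for completeness `X ∣ ι(X) − X` (the constant term vanishes: at the bottom layer `ι` is the
identity — the graph pairing IS alternating modulo `T`, which is why (ND) was needed at level `1`).
[folklore] -/
theorem X_dvd_inv_sub_one_sub_X {k : Type*} [Field k] :
    (X : k⟦X⟧) ∣ ((1 + X : k⟦X⟧)⁻¹ - 1) - X := by
  rw [X_dvd_iff, ← coeff_zero_eq_constantCoeff_apply]
  exact (coeff_inv_sub_one_sub_X ((1 + X : k⟦X⟧)⁻¹) one_add_X_mul_inv).1

/-- **The pairing along an `ι`-semilinear graph against an alternating form (memo (5.7.B.1)).**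
Bookkeeping identity in a commutative ring `A` (the memo's `A_e`): for the values
`e₁₁ = e₂₂ = 0`, `e₂₁ = ε`, `e₁₂ = −ε` of an alternating form on a basis `v₁, v₂`, coordinates
`a₁, a₂` of `x = v₁⊗a₁ + v₂⊗a₂`, their images `i₁ = ι(a₁)`, `i₂ = ι(a₂)` under any map `ι`, and a
scalar `u` (so that `θ(x) = Σ_k [w(v_k) ⊗ i_k u]`), the double sum `Σ_{i,k} e(v_k, v_i)·a_i·(i_k u)`
computing `⟨x, θ(x)⟩` (memo (N2.1)) equals `u·ε·(a₁ i₂ − a₂ i₁)`. With `a₁ = 1`, `a₂ = T`, `ι(1) = 1`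
this is `u·ε·(ι(T) − T)`, non-zero mod `T²` by `not_X_sq_dvd_inv_sub_one_sub_X`. [folklore] -/
theorem graph_pairing_expansion {A : Type*} [CommRing A] (ε u a₁ a₂ i₁ i₂ : A)
    (e₁₁ e₁₂ e₂₁ e₂₂ : A) (h11 : e₁₁ = 0) (h22 : e₂₂ = 0) (h21 : e₂₁ = ε) (h12 : e₁₂ = -ε) :
    (e₁₁ * a₁ * (i₁ * u) + e₂₁ * a₁ * (i₂ * u)) + (e₁₂ * a₂ * (i₁ * u) + e₂₂ * a₂ * (i₂ * u)) =
      u * ε * (a₁ * i₂ - a₂ * i₁) := by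
  subst h11 h22 h21 h12
  ring

/-- The special case used in Theorem 5.7.1: `a₁ = 1`, `a₂ = T`, `ι(1) = 1`, `ι(T) = j`: the graph
pairing is `u·ε·(j − T)` — i.e. `u·ε·(ι(T) − T)`. [folklore] -/
theorem graph_pairing_at_one_T {A : Type*} [CommRing A] (ε u T j : A)
    (e₁₁ e₁₂ e₂₁ e₂₂ : A) (h11 : e₁₁ = 0) (h22 : e₂₂ = 0) (h21 : e₂₁ = ε) (h12 : e₁₂ = -ε) :
    (e₁₁ * 1 * (1 * u) + e₂₁ * 1 * (j * u)) + (e₁₂ * T * (1 * u) + e₂₂ * T * (j * u)) =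
      u * ε * (j - T) := by
  rw [graph_pairing_expansion ε u 1 T 1 j e₁₁ e₁₂ e₂₁ e₂₂ h11 h22 h21 h12]
  ring

end Summit.BirchSwinnertonDyer.BirchSwinnertonDyer.Rank1Residual.IotaPairing
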